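/-
Copyright (c) 2026. All rights reserved.
Released under Apache 2.0 license as described in the file LICENSE.
Authors: abc-iut cell — seat abc-iut-f-060 (block F fact-proving wave; FACT-LIST row F-0208
`CuspidalData.NonProperIffFree` added to the closed product-model instance, on abc-iut-L4-t15's pointer).
-/
import Literature.AnabelianGeometry.AbsoluteAnabelian.AbsTopIChainsCuspidalProductModel
import Literature.AnabelianGeometry.AbsoluteAnabelian.AbsTopILem45iModelProofs
import Literature.AnabelianGeometry.SemiGraphs.ProSigmaCompletionModels
import Literature.AnabelianGeometry.SemiGraphs.ProSigmaCompletionTransport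
import Literature.AnabelianGeometry.SemiGraphs.SurfaceTypeLoopModels
import Literature.GroupTheory.CombinatorialGroupTheory.PuncturedSurfaceGroupFree
import HarnessLib

/-!
# [AbsTopI] Lemma 4.5 (i), (vi) + [AbsAnab] 1.3.7 + [AbsTopIII] 1.11 (b), 1.4 (i): FIVE typed cusp predicates
# hold together at `Π = G × F̂₂`, one cusp `D = G × Ẑ·a`

S. Mochizuki, *Topics in Absolute Anabelian Geometry I* [MochizukiAbsTopI2012], Lemma 4.5 (i) p. 54: "`X` is
non-proper [i.e., has a cusp] if and only if every torsion-free pro-`Σ` open subgroup of `Δ` is free pro-`Σ`",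
typed by abc-iut-L4-t4 as `CuspidalData.NonProperIffFree C Σ` (FACT-LIST row F-0208; a schema over abstract
cuspidal data — universal closure refuted in `AbsTopIChainsCuspidalFacts.lean`; PROVED by abc-iut-L4-t15 at the
affine and proper surface-group models, `AbsTopILem45iModelProofs.lean`).

PROOF-ONLY composition (no `def` / `instance` / `structure`): the closed product model of
`AbsTopIChainsCuspidalProductModel.lean` — `Π := G × F̂₂ ↠ G`, `Δ ≃ₜ* F̂₂`, ONE cusp `D = G × îa(Ẑ)`, at which
(vi) F-0207, [AbsAnab] Lemma 1.3.7 F-0003, [AbsTopIII] Thm 1.11 (b) F-0405 and Prop 1.4 (i) F-0406 hold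
(`CuspidalData.exists_prod_freeTwo_model`) — ALSO satisfies Lemma 4.5 (i) F-0208 for `Σ = 𝔓𝔯𝔦𝔪𝔢𝔰`
(`CuspidalData.exists_prod_freeTwo_model_nonProperIffFree`): `Δ ≃ₜ* F̂₂` receives the pro-`𝔓𝔯𝔦𝔪𝔢𝔰` completion
`Γ_{1,1} ≅ F₂ → F̂₂ ≅ Δ` of the once-punctured-torus group (abc-iut-L3's `isProSigmaCompletion_toCompletion`
transported along the two isomorphisms), the datum HAS a cusp, and abc-iut-L4-t15's
`CuspidalData.nonProperIffFree_of_isProSigmaCompletion_puncturedSurfaceGroup` (every open subgroup of the free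
profinite `Δ` is free profinite, Schreier) gives the `↔`.  The existential of the product-model file is consumed
BY NAME through its exported `Δ ≃ₜ* F̂₂` — nothing is re-constructed.

HONEST LABEL: a direct product with a hand-placed cusp (consistency evidence that the five typed predicates are
jointly satisfiable at a genuine free-profinite `Δ` with an arbitrary profinite `G`, e.g. `G_{ℚ_p}`), not the
étale `π₁` of a curve; instantiated ≠ endorsed; nothing here bears on [IUTchIII] Cor. 3.12; typed ≠ proved
elsewhere.
-/

noncomputable section

namespace Literature.AnabelianGeometry.AbsoluteAnabelian.FundamentalExtension

open Literature.IUT.HodgeTheaters (profiniteCompletion toCompletion)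
open Literature.AnabelianGeometry.SemiGraphs
open Literature.GroupTheory.CombinatorialGroupTheory

/-- **Joint closed instance of F-0207 / F-0003 / F-0405 / F-0406 / F-0208 at `Π = G × F̂₂`, one cusp
`D = G × cl η⟨a⟩`.**  For every profinite group `G` there are an extension `E` with `G_E = G`, `Π_E = G × F̂₂`,
`Δ_E ≃ₜ* F̂₂` and a single-cusp cuspidal datum `C` satisfying `DecompEqCommensuratorOfInertia`,
`InertiaCommensurablyTerminal`, `DecompEqNormalizer`, `InertiaFreeProcyclic` AND `NonProperIffFree 𝔓𝔯𝔦𝔪𝔢𝔰`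
([AbsTopI] Lemma 4.5 (i) as typed: `C` has a cusp, and every torsion-free open subgroup of the free profinite
`Δ ≅ F̂₂` is free profinite). [cite: MochizukiAbsTopI2012, Lemma 4.5 (i) p.54] -/
theorem CuspidalData.exists_prod_freeTwo_model_nonProperIffFree (G : ProfiniteGrp.{0}) :
    ∃ (E : FundamentalExtension.{0}) (C : CuspidalData E),
      E.gal = G ∧ E.arith = ProfiniteGrp.of (G × profiniteCompletion (FreeGroup (Fin 2))) ∧
      Nonempty (E.geom ≃ₜ* profiniteCompletion (FreeGroup (Fin 2))) ∧ Nonempty C.Cusp ∧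
      C.DecompEqCommensuratorOfInertia ∧ C.InertiaCommensurablyTerminal ∧ C.DecompEqNormalizer ∧
        C.InertiaFreeProcyclic ∧ C.NonProperIffFree {p : ℕ | p.Prime} := by
  classical
  obtain ⟨E, C, hgal, harith, ⟨eΔ⟩, hne, h₁, h₂, h₃, h₄⟩ := CuspidalData.exists_prod_freeTwo_model G
  haveI : Nonempty C.Cusp := hne
  -- `Γ_{1,1} ≅ F₂` (the once-punctured torus group is free on `a₁, b₁`)
  obtain ⟨e₀⟩ := PuncturedSurfaceGroup.nonempty_mulEquiv_freeGroup 1 0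
  let e₁ : ((Fin 1 × Bool) ⊕ Fin 0) ≃ Fin 2 := Fintype.equivFinOfCardEq (by simp)
  let ψ : PuncturedSurfaceGroup 1 1 ≃* FreeGroup (Fin 2) := e₀.trans (FreeGroup.freeGroupCongr e₁)
  -- `ι : Γ_{1,1} ≅ F₂ → F̂₂ ≅ Δ`, a pro-`𝔓𝔯𝔦𝔪𝔢𝔰` completion
  let ι : PuncturedSurfaceGroup 1 1 →* E.geom :=
    (eΔ.symm.toMulEquiv.toMonoidHom).comp ((toCompletion (FreeGroup (Fin 2))).comp ψ.toMonoidHom)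
  have hι : SemiGraphOfAnabelioids.IsProSigmaCompletion {p : ℕ | p.Prime} ι :=
    ((SemiGraphOfAnabelioids.IsProSigmaCompletion.isProSigmaCompletion_toCompletion
      (FreeGroup (Fin 2))).comp_mulEquiv ψ).comp_continuousMulEquiv eΔ.symm
  have hgr : PuncturedSurfaceGroup.IsHyperbolicType 1 1 := by
    unfold PuncturedSurfaceGroup.IsHyperbolicType; omega
  exact ⟨E, C, hgal, harith, ⟨eΔ⟩, hne, h₁, h₂, h₃, h₄,
    C.nonProperIffFree_of_isProSigmaCompletion_puncturedSurfaceGroup le_rfl hgr ι hι⟩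

end Literature.AnabelianGeometry.AbsoluteAnabelian.FundamentalExtension

end
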